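import Summits.CriticalPhenomena.PercolationContinuityZ3.Theorems.Transplant.FKConnectivityAllQAntipodalX2WordsTrichotomy
import HarnessLib

/-!
# Connectivity correlation inequalities for `φ_{w,q}` — the TYPE-WORD MODEL of `X2`, file 8: SOLITON words — structure, rows,
# loser test and level (memo g13 §4)

Helper file (`--supports stmt-CriticalPhenomena-4575`), FK sub-lane `prim-bschramm-fk-2` (gen 13); builds on p205010 (kernel
theorem, internal audit signed; external expert review pending).  Pure finite combinatorics on the type-word model of
`…AntipodalX2Words` (memo `bschramm/FROM-fk-2-g13-WORD-HALL.md`).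
* `alt`, `solitonPattern_eq`: a soliton word is `E^h ++ (F E F … F) ++ E^c`; `hull_solitonPattern`, `ruleN_solitonPattern` (RULE N
  returns the soliton window);
* `rows_soliton_W/P`, `soliton_W_loser_level` (a `W`-soliton word is a loser iff a `P`-block follows the train; level
  `m + 1 + [h ≥ 1]`), `soliton_P_loser_level` (loser iff `h ≥ 1` and some `P`-block lies outside; level `m + 2`),
  `ground_loser_level` (loser iff a `P`-block exists; level `1`).
[cite: Grimmett2006, §3.9 (p. 63)]
-/

namespace Summit.CriticalPhenomena.PercolationContinuityZ3.Theorems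

namespace FK

namespace X2Word

/-! ### Soliton words: structure, rows, and the soliton shift (memo g13 §4) -/

section SolitonRows

/-- The alternating train `F E F E … F` with `m + 1` flipped blocks (`2m + 1` blocks). [folklore] -/
def alt : ℕ → List Ty
  | 0 => [.F]
  | m + 1 => alt m ++ [.E, .F]

/-- Length of the train. [folklore] -/
@[simp] theorem length_alt (m : ℕ) : (alt m).length = 2 * m + 1 := by
  induction m with
  | zero => rfl
  | succ m ih => simp [alt, ih]; omega

/-- The train as a `range`-map: `F` at even offsets, `E` at odd ones. [folklore] -/
theorem alt_eq_map (m : ℕ) : alt m = (List.range (2 * m + 1)).map fun j => if j % 2 = 0 then Ty.F else Ty.E := by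
  induction m with
  | zero => rfl
  | succ m ih =>
    have h1 : ¬ (2 * m + 1) % 2 = 0 := by omega
    have h2 : (2 * m + 2) % 2 = 0 := by omega
    have e : List.range (2 * (m + 1) + 1) = List.range (2 * m + 1) ++ [2 * m + 1, 2 * m + 2] := by
      rw [show 2 * (m + 1) + 1 = 2 * m + 1 + 1 + 1 by ring, List.range_succ, List.range_succ]
      simp
    rw [alt, ih, e, List.map_append]
    simp [h2]

/-- Entries of the train. [folklore] -/
theorem getElem_alt (m j : ℕ) (hj : j < (alt m).length) : (alt m)[j] = if j % 2 = 0 then Ty.F else Ty.E := by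
  rw [List.getElem_of_eq (alt_eq_map m) hj]
  simp

/-- A soliton word is `E^h ++ train ++ E^(n - h - 2m - 1)`. [folklore] -/
theorem solitonPattern_eq (n h m : ℕ) (hn : h + 2 * m < n) :
    solitonPattern n h m = List.replicate h .E ++ alt m ++ List.replicate (n - h - 2 * m - 1) .E := by
  apply List.ext_getElem
  · simp; omega
  · intro j h1 h2
    rw [getElem_solitonPattern]
    simp only [List.append_assoc]
    by_cases hj : j < h
    · rw [List.getElem_append_left (by simpa using hj)]
      simp [List.getElem_replicate]; omega
    · rw [List.getElem_append_right (by simpa using hj)]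
      by_cases hj2 : j - h < 2 * m + 1
      · have hj2' : j - (List.replicate h Ty.E).length < (alt m).length := by simpa using hj2
        rw [List.getElem_append_left hj2', getElem_alt]
        simp only [List.length_replicate]
        by_cases hpar : (j - h) % 2 = 0
        · simp [hpar]; omega
        · simp [hpar]
      · have hj2' : ¬ j - (List.replicate h Ty.E).length < (alt m).length := by simpa using hj2
        rw [List.getElem_append_right (not_lt.mp hj2')]
        simp [List.getElem_replicate]; omega

/-- Row `A` does not see a train read from a `W`-block … [folklore] -/
theorem rowA_W_alt (m : ℕ) : rowA .W (alt m) = [] := by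
  induction m with
  | zero => rfl
  | succ m ih => rw [alt, rowA_append, ih, length_alt, kindAt_eq_of_mod]; simp [rowA_cons, visA, show (2 * m + 1) % 2 = 1 by omega]

/-- … and row `B` does not see a train read from a `P`-block. [folklore] -/
theorem rowB_P_alt (m : ℕ) : rowB .P (alt m) = [] := by
  induction m with
  | zero => rfl
  | succ m ih => rw [alt, rowB_append, ih, length_alt, kindAt_eq_of_mod]; simp [rowB_cons, visB, show (2 * m + 1) % 2 = 1 by omega]

/-- The alternating kind word `k, k', k, …, k` of length `2m+1`. [folklore] -/
def altK (k : Kind) : ℕ → List Kind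
  | 0 => [k]
  | m + 1 => altK k m ++ [k.other, k]

/-- Row `B` of a train read from a `W`-block sees every block. [folklore] -/
theorem rowB_W_alt (m : ℕ) : rowB .W (alt m) = altK .W m := by
  induction m with
  | zero => rfl
  | succ m ih => rw [alt, rowB_append, ih, length_alt, kindAt_eq_of_mod, altK]; simp [rowB_cons, visB, show (2 * m + 1) % 2 = 1 by omega]

/-- Row `A` of a train read from a `P`-block sees every block. [folklore] -/
theorem rowA_P_alt (m : ℕ) : rowA .P (alt m) = altK .P m := by
  induction m with
  | zero => rfl
  | succ m ih => rw [alt, rowA_append, ih, length_alt, kindAt_eq_of_mod, altK]; simp [rowA_cons, visA, show (2 * m + 1) % 2 = 1 by omega]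

/-- The alternating kind word is nonempty. [folklore] -/
theorem altK_ne_nil (k : Kind) (m : ℕ) : altK k m ≠ [] := by
  cases m <;> simp [altK]

/-- It starts with `k` … [folklore] -/
theorem headP_altK (k : Kind) (m : ℕ) : headP (altK k m) = decide (k = .P) := by
  induction m with
  | zero => cases k <;> rfl
  | succ m ih => rw [altK, headP_append, if_neg (altK_ne_nil k m), ih]

/-- … ends with `k` … [folklore] -/
theorem lastP_altK (k : Kind) (m : ℕ) : lastP (altK k m) = decide (k = .P) := by
  cases m with
  | zero => cases k <;> rfl
  | succ m => rw [altK, lastP_append]; cases k <;> simp [lastP]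

/-- … and has `m` particle runs if `k = W`, `m + 1` if `k = P`. [folklore] -/
theorem runsP_altK (k : Kind) (m : ℕ) : runsP (altK k m) = m + (if k = .P then 1 else 0) := by
  induction m with
  | zero => cases k <;> rfl
  | succ m ih =>
    rw [altK]
    unfold runsP at ih ⊢
    rw [runsAux_append, ih, lastFlag_of_ne_nil _ (altK_ne_nil k m), lastP_altK]
    cases k <;> simp [runsAux]

/-- Row `A` of a ground word is empty iff it has no `W`-block: length `0`, or length `1` read from a `P`-block. [folklore] -/
theorem rowA_replicate_eq_nil_iff (k : Kind) (n : ℕ) : rowA k (List.replicate n .E) = [] ↔ n = 0 ∨ (n = 1 ∧ k = .P) := by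
  rw [rowA_eq_nil_iff]
  simp only [List.length_replicate, List.getElem_replicate]
  constructor
  · intro hall
    rcases Nat.lt_or_ge n 2 with hn | hn
    · rcases Nat.lt_or_ge n 1 with hn1 | hn1
      · left; omega
      · right; refine ⟨by omega, ?_⟩
        have := hall 0 (by omega); cases k <;> simp [kindAt, visA] at this ⊢
    · exfalso
      have h0 := hall 0 (by omega); have h1 := hall 1 (by omega)
      cases k <;> simp [kindAt, visA] at h0 h1
  · rintro (rfl | ⟨rfl, rfl⟩) j hj
    · omega
    · have : j = 0 := by omega
      subst this; simp [visA]

/-- Row `B` of a ground word is empty iff it has no `P`-block. [folklore] -/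
theorem rowB_replicate_eq_nil_iff (k : Kind) (n : ℕ) : rowB k (List.replicate n .E) = [] ↔ n = 0 ∨ (n = 1 ∧ k = .W) := by
  rw [rowB_eq_nil_iff]
  simp only [List.length_replicate, List.getElem_replicate]
  constructor
  · intro hall
    rcases Nat.lt_or_ge n 2 with hn | hn
    · rcases Nat.lt_or_ge n 1 with hn1 | hn1
      · left; omega
      · right; refine ⟨by omega, ?_⟩
        have := hall 0 (by omega); cases k <;> simp [kindAt, visB] at this ⊢
    · exfalso
      have h0 := hall 0 (by omega); have h1 := hall 1 (by omega)
      cases k <;> simp [kindAt, visB] at h0 h1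
  · rintro (rfl | ⟨rfl, rfl⟩) j hj
    · omega
    · have : j = 0 := by omega
      subst this; simp [visB]

end SolitonRows

/-! ### Hull, RULE N, loser test and level of a soliton word -/

section SolitonFacts

variable {k₀ : Kind}

/-- The hull of a soliton word is `[h, h + 2m]`. [folklore] -/
theorem hull_solitonPattern {n h m : ℕ} (hn : h + 2 * m < n) :
    hullStart (solitonPattern n h m) = some h ∧ hullEnd (solitonPattern n h m) = some (h + 2 * m) := by
  constructor
  · rw [hullStart_eq_some_iff]
    refine ⟨by simp; omega, ?_, ?_⟩
    · rw [getElem_solitonPattern]; simp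
    · intro j hj; rw [getElem_solitonPattern]; simp; omega
  · rw [hullEnd_eq_some_iff]
    refine ⟨by simp; omega, ?_, ?_⟩
    · rw [getElem_solitonPattern]; simp
    · intro j hj hlt; rw [getElem_solitonPattern]; simp; omega

/-- RULE N on a soliton word returns the soliton window. [folklore] -/
theorem ruleN_solitonPattern {n h m : ℕ} (hn : h + 2 * m < n) :
    ruleN k₀ (solitonPattern n h m) = some (solitonWindow (kindAt k₀ h) h m) := by
  obtain ⟨hs, he⟩ := hull_solitonPattern hn
  unfold ruleN
  rw [hs, he]
  have hm : (h + 2 * m - h) / 2 = m := by omega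
  simp only [hm, isSoliton, length_solitonPattern, hn, decide_true, Bool.and_self, if_true]

/-- Entries of a window swap. [folklore] -/
theorem getElem_swapWin (s t : ℕ) (x : List Ty) (j : ℕ) (hj : j < (swapWin s t x).length) :
    (swapWin s t x)[j] = if s ≤ j ∧ j ≤ t then (x[j]'(by simpa using hj)).swap else x[j]'(by simpa using hj) := by
  simp [swapWin, List.getElem_mapIdx]

/-- Rows of a `W`-soliton word: row `A` is all walls, row `B` is `P^c ++ (W P … W) ++ P^c'`. [folklore] -/
theorem rows_soliton_W {n h m : ℕ} (hn : h + 2 * m < n) (hk : kindAt k₀ h = .W) :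
    rowA k₀ (solitonPattern n h m) =
      rowA k₀ (List.replicate h .E) ++ rowA .P (List.replicate (n - h - 2 * m - 1) .E) ∧
    rowB k₀ (solitonPattern n h m) =
      rowB k₀ (List.replicate h .E) ++ altK .W m ++ rowB .P (List.replicate (n - h - 2 * m - 1) .E) := by
  have hk' : kindAt k₀ (h + (alt m).length) = .P := by
    rw [length_alt, kindAt_add, hk, kindAt_eq_of_mod]; simp [show (2 * m + 1) % 2 = 1 by omega]
  rw [solitonPattern_eq n h m hn, rowA_decomp, rowB_decomp, hk, hk', rowA_W_alt, rowB_W_alt, List.append_nil]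
  exact ⟨rfl, rfl⟩

/-- Rows of a `P`-soliton word: row `A` is `W^a ++ (P W … P) ++ W^a'`, row `B` is all particles. [folklore] -/
theorem rows_soliton_P {n h m : ℕ} (hn : h + 2 * m < n) (hk : kindAt k₀ h = .P) :
    rowA k₀ (solitonPattern n h m) =
      rowA k₀ (List.replicate h .E) ++ altK .P m ++ rowA .W (List.replicate (n - h - 2 * m - 1) .E) ∧
    rowB k₀ (solitonPattern n h m) =
      rowB k₀ (List.replicate h .E) ++ rowB .W (List.replicate (n - h - 2 * m - 1) .E) := by
  have hk' : kindAt k₀ (h + (alt m).length) = .W := by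
    rw [length_alt, kindAt_add, hk, kindAt_eq_of_mod]; simp [show (2 * m + 1) % 2 = 1 by omega]
  rw [solitonPattern_eq n h m hn, rowA_decomp, rowB_decomp, hk, hk', rowA_P_alt, rowB_P_alt, List.append_nil]
  exact ⟨rfl, rfl⟩

/-- Loser test and level of a `W`-soliton word: a loser iff a `P`-block follows the train, and then its level is
`m + 1 + [h ≥ 1]` (memo g13 §4). [folklore] -/
theorem soliton_W_loser_level {n h m : ℕ} (hn : h + 2 * m < n) (hk : kindAt k₀ h = .W) :
    isLoser k₀ (solitonPattern n h m) = decide (h + 2 * m + 1 < n) ∧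
    (h + 2 * m + 1 < n → level k₀ (solitonPattern n h m) = m + 1 + (if 1 ≤ h then 1 else 0)) := by
  obtain ⟨hrA, hrB⟩ := rows_soliton_W (k₀ := k₀) hn hk
  have hpa := rowA_ground_allW k₀ h
  have hsa := rowA_ground_allW .P (n - h - 2 * m - 1)
  have hpb := rowB_ground_allP k₀ h
  have hsb := rowB_ground_allP .P (n - h - 2 * m - 1)
  have hAW : ∀ a ∈ rowA k₀ (solitonPattern n h m), a = .W := by
    rw [hrA]; intro a ha; rcases List.mem_append.mp ha with h1 | h1; exact hpa a h1; exact hsa a h1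
  have hne := altK_ne_nil .W m
  -- is the block after the train present?
  have hsb_ne : (rowB .P (List.replicate (n - h - 2 * m - 1) .E) ≠ []) ↔ h + 2 * m + 1 < n := by
    rw [Ne, rowB_replicate_eq_nil_iff]; constructor
    · intro hc; by_contra hc'; exact hc (Or.inl (by omega))
    · rintro hc (h0 | ⟨-, h1⟩)
      · omega
      · exact absurd h1 (by decide)
  have hpb_ne : (rowB k₀ (List.replicate h .E) ≠ []) ↔ 1 ≤ h := by
    rw [Ne, rowB_replicate_eq_nil_iff]; constructor
    · intro hc; by_contra hc'; exact hc (Or.inl (by omega))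
    · rintro hc (h0 | ⟨h0, h1⟩)
      · omega
      · subst h0 h1; simp [kindAt] at hk
  constructor
  · unfold isLoser
    rw [headP_of_allW hAW, lastP_of_allW hAW, hrB, lastP_P_mid_P _ hsb hne, lastP_altK]
    by_cases hc : h + 2 * m + 1 < n
    · have : rowB Kind.P (List.replicate (n - h - 2 * m - 1) Ty.E) ≠ [] := hsb_ne.mpr hc
      simp [this, hc]
    · have : rowB Kind.P (List.replicate (n - h - 2 * m - 1) Ty.E) = [] := by
        by_contra h0; exact hc (hsb_ne.mp h0)
      simp [this, hc]
  · intro hc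
    unfold level runsP
    rw [runsAux_of_allW _ hAW, hrB]
    change 0 + runsP _ = _
    rw [runsP_P_mid_P hpb hsb hne, runsP_altK, headP_altK, lastP_altK]
    have h1 : rowB Kind.P (List.replicate (n - h - 2 * m - 1) Ty.E) ≠ [] := hsb_ne.mpr hc
    by_cases hh : 1 ≤ h
    · have h2 : rowB k₀ (List.replicate h .E) ≠ [] := hpb_ne.mpr hh
      simp [h1, h2, hh]
    · have h2 : rowB k₀ (List.replicate h .E) = [] := by by_contra h0; exact hh (hpb_ne.mp h0)
      simp [h1, h2, hh]

/-- Loser test and level of a `P`-soliton word: a loser iff `h ≥ 1` and some `P`-block lies outside the train, and then its level is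
`m + 2` (memo g13 §4). [folklore] -/
theorem soliton_P_loser_level {n h m : ℕ} (hn : h + 2 * m < n) (hk : kindAt k₀ h = .P) :
    isLoser k₀ (solitonPattern n h m) = decide (1 ≤ h ∧ (2 ≤ h ∨ h + 2 * m + 2 < n)) ∧
    (1 ≤ h ∧ (2 ≤ h ∨ h + 2 * m + 2 < n) → level k₀ (solitonPattern n h m) = m + 2) := by
  obtain ⟨hrA, hrB⟩ := rows_soliton_P (k₀ := k₀) hn hk
  have hpa := rowA_ground_allW k₀ h
  have hsa := rowA_ground_allW .W (n - h - 2 * m - 1)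
  have hpb := rowB_ground_allP k₀ h
  have hsb := rowB_ground_allP .W (n - h - 2 * m - 1)
  have hBP : ∀ a ∈ rowB k₀ (solitonPattern n h m), a = .P := by
    rw [hrB]; intro a ha; rcases List.mem_append.mp ha with h1 | h1; exact hpb a h1; exact hsb a h1
  have hne := altK_ne_nil .P m
  have hpa_ne : (rowA k₀ (List.replicate h .E) ≠ []) ↔ 1 ≤ h := by
    rw [Ne, rowA_replicate_eq_nil_iff]; constructor
    · intro hc; by_contra hc'; exact hc (Or.inl (by omega))
    · rintro hc (h0 | ⟨h0, h1⟩)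
      · omega
      · subst h0 h1; simp [kindAt] at hk
  have hsa_ne : (rowA .W (List.replicate (n - h - 2 * m - 1) .E) ≠ []) ↔ h + 2 * m + 1 < n := by
    rw [Ne, rowA_replicate_eq_nil_iff]; constructor
    · intro hc; by_contra hc'; exact hc (Or.inl (by omega))
    · rintro hc (h0 | ⟨-, h1⟩)
      · omega
      · exact absurd h1 (by decide)
  have hB_ne : (rowB k₀ (solitonPattern n h m) ≠ []) ↔ (2 ≤ h ∨ h + 2 * m + 2 < n) := by
    rw [hrB, Ne, List.append_eq_nil_iff, rowB_replicate_eq_nil_iff, rowB_replicate_eq_nil_iff]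
    constructor
    · intro hc
      by_contra hc'
      apply hc
      refine ⟨?_, ?_⟩
      · rcases Nat.lt_or_ge h 1 with h0 | h0
        · exact Or.inl (by omega)
        · right
          have h1 : h = 1 := by omega
          subst h1
          refine ⟨rfl, ?_⟩
          cases k₀
          · rfl
          · simp [kindAt] at hk
      · rcases Nat.lt_or_ge (n - h - 2 * m - 1) 1 with h0 | h0
        · exact Or.inl (by omega)
        · exact Or.inr ⟨by omega, rfl⟩
    · rintro hc ⟨h1, h2⟩
      rcases hc with hc | hc
      · rcases h1 with h1 | ⟨h1, -⟩ <;> omega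
      · rcases h2 with h2 | ⟨h2, -⟩ <;> omega
  constructor
  · unfold isLoser
    rw [hrA, headP_W_mid_W hpa _ hne, lastP_W_mid_W _ hsa hne, headP_altK, lastP_altK]
    by_cases hh : 1 ≤ h
    · have h2 : rowA k₀ (List.replicate h .E) ≠ [] := hpa_ne.mpr hh
      by_cases hc : 2 ≤ h ∨ h + 2 * m + 2 < n
      · have h3 : rowB k₀ (solitonPattern n h m) ≠ [] := hB_ne.mpr hc
        rw [headP_of_allP hBP h3, lastP_of_allP hBP h3]
        simp [h2, hh, hc]
      · have h3 : rowB k₀ (solitonPattern n h m) = [] := by by_contra h0; exact hc (hB_ne.mp h0)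
        rw [h3]
        simp [h2, hh, hc, headP, lastP]
    · have h2 : rowA k₀ (List.replicate h .E) = [] := by by_contra h0; exact hh (hpa_ne.mp h0)
      simp [h2, hh]
  · rintro ⟨hh, hc⟩
    have h3 : rowB k₀ (solitonPattern n h m) ≠ [] := hB_ne.mpr hc
    unfold level
    rw [hrA, runsP_W_mid_W hpa hsa, runsP_altK]
    unfold runsP
    rw [runsAux_of_allP _ hBP]
    simp [h3]

/-- Loser test and level of the ground word: a loser iff it has a `P`-block, and then its level is `1`. [folklore] -/
theorem ground_loser_level (k₀ : Kind) (n : ℕ) :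
    isLoser k₀ (List.replicate n .E) = decide (¬ (n = 0 ∨ (n = 1 ∧ k₀ = .W))) ∧
    (¬ (n = 0 ∨ (n = 1 ∧ k₀ = .W)) → level k₀ (List.replicate n .E) = 1) := by
  have hpa := rowA_ground_allW k₀ n
  have hpb := rowB_ground_allP k₀ n
  have hB_ne : rowB k₀ (List.replicate n .E) ≠ [] ↔ ¬ (n = 0 ∨ (n = 1 ∧ k₀ = .W)) := by
    rw [Ne, rowB_replicate_eq_nil_iff]
  constructor
  · unfold isLoser
    rw [headP_of_allW hpa, lastP_of_allW hpa]
    by_cases hc : (n = 0 ∨ (n = 1 ∧ k₀ = .W))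
    · have h3 : rowB k₀ (List.replicate n .E) = [] := by by_contra h0; exact (hB_ne.mp h0) hc
      rw [h3]; simp [hc, lastP]
    · rw [lastP_of_allP hpb (hB_ne.mpr hc)]; simp [hc]
  · intro hc
    unfold level runsP
    rw [runsAux_of_allW _ hpa, runsAux_of_allP _ hpb]
    simp [hB_ne.mpr hc]

end SolitonFacts


end X2Word

end FK

end Summit.CriticalPhenomena.PercolationContinuityZ3.Theorems
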